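import Mathlib
import Literature.Probability.LatticeModels.IndependencePolynomial

/-!
# The blow-up identity for the independence polynomial

Replacing every vertex of a finite simple graph `G` by `t` pairwise non-adjacent twins and every
edge by a complete bipartite graph `K_{t,t}` yields the lexicographic product `G[K̄_t]`, realised
here as `SimpleGraph.comap Prod.fst G` on `V × Fin t` (`(a, i) ∼ (b, j) ↔ G.Adj a b`). Its
independent sets are exactly the independent sets `J` of `G` decorated at each `a ∈ J` by a
non-empty set of twins, whence `Z_{G[K̄_t]}(z) = Z_G((1 + z) ^ t - 1)` (`stub_blowup`).
-/

set_option linter.dupNamespace false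

namespace Summit.PneNP.PneNP.Theorems.NoFBPPApproxAboveUniqueness

open Literature.Probability.LatticeModels Finset

section Helpers

variable {V : Type*} [Fintype V]

/-- The set of pairs with prescribed fibres `φ` is independent in the blow-up
`SimpleGraph.comap Prod.fst G` iff the set of vertices with non-empty fibre is independent in `G`
(twins are never adjacent, since `G` is loopless). [folklore] -/
theorem isIndepSet_comap_fst_filter_iff (G : SimpleGraph V) (t : ℕ) (φ : V → Finset (Fin t)) :
    (SimpleGraph.comap Prod.fst G : SimpleGraph (V × Fin t)).IsIndepSet
        ↑(univ.filter fun p : V × Fin t => p.2 ∈ φ p.1) ↔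
      G.IsIndepSet ↑(univ.filter fun a : V => (φ a).Nonempty) := by
  simp only [SimpleGraph.isIndepSet_iff, Set.Pairwise, coe_filter, mem_univ, true_and,
    Set.mem_setOf_eq, SimpleGraph.comap_adj, ne_eq, Prod.forall, Prod.mk.injEq, not_and]
  constructor
  · rintro h a ⟨i, hi⟩ b ⟨j, hj⟩ hab
    exact h a i hi b j hj fun h' => absurd h' hab
  · intro h a i hi b j hj hne hadj
    by_cases hab : a = b
    · subst hab
      exact G.irrefl hadj
    · exact h ⟨i, hi⟩ ⟨j, hj⟩ hab hadj

/-- `z ^ #{(a, i) | i ∈ φ a} = ∏ₐ z ^ #(φ a)`. [folklore] -/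
theorem pow_card_filter_eq_prod {R : Type*} [CommSemiring R] (z : R) (t : ℕ)
    (φ : V → Finset (Fin t)) :
    z ^ (univ.filter fun p : V × Fin t => p.2 ∈ φ p.1).card = ∏ a, z ^ (φ a).card := by
  rw [← prod_const z, prod_filter, Fintype.prod_prod_type]
  refine Fintype.prod_congr _ _ fun a => ?_
  simp only [Fintype.prod_ite_mem, prod_const]

/-- `∑_{∅ ≠ S ⊆ Fin t} z ^ #S = (1 + z) ^ t - 1` (binomial theorem minus the empty set).
[folklore] -/
theorem sum_pow_card_erase_empty {R : Type*} [CommRing R] (z : R) (t : ℕ) :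
    ∑ S ∈ (univ : Finset (Finset (Fin t))).erase ∅, z ^ S.card = (1 + z) ^ t - 1 := by
  have h := Fintype.sum_pow_mul_eq_add_pow (Fin t) z 1
  simp only [one_pow, mul_one, Fintype.card_fin] at h
  rw [eq_sub_iff_add_eq, add_comm (1 : R) z, ← h, ← pow_zero z, ← card_empty,
    sum_erase_add _ _ (mem_univ _)]

/-- Expanding `((1 + z) ^ t - 1) ^ #J` as a sum over fibre functions supported exactly on `J`:
each `a ∈ J` picks a non-empty set of twins, each `a ∉ J` the empty one. [folklore] -/
theorem pow_card_eq_sum_piFinset [DecidableEq V] {R : Type*} [CommRing R] (z : R) (t : ℕ)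
    (J : Finset V) :
    ((1 + z) ^ t - 1) ^ J.card =
      ∑ φ ∈ Fintype.piFinset fun a =>
          if a ∈ J then (univ : Finset (Finset (Fin t))).erase ∅ else {∅},
        ∏ a, z ^ (φ a).card := by
  refine Eq.trans ?_ (prod_univ_sum _ fun _ (S : Finset (Fin t)) => z ^ S.card)
  rw [← prod_const, ← Fintype.prod_ite_mem]
  refine Fintype.prod_congr _ _ fun a => ?_
  split_ifs
  · rw [sum_pow_card_erase_empty]
  · rw [sum_singleton, card_empty, pow_zero]

/-- Membership in the fibre box of `pow_card_eq_sum_piFinset`: `φ` lies in it iff its support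
(the set of vertices with non-empty fibre) is exactly `J`. [folklore] -/
theorem mem_piFinset_iff_filter_nonempty_eq [DecidableEq V] (t : ℕ) (J : Finset V)
    (φ : V → Finset (Fin t)) :
    (φ ∈ Fintype.piFinset fun a =>
        if a ∈ J then (univ : Finset (Finset (Fin t))).erase ∅ else {∅}) ↔
      (univ.filter fun a : V => (φ a).Nonempty) = J := by
  rw [Fintype.mem_piFinset, Finset.ext_iff]
  refine forall_congr' fun a => ?_
  simp only [mem_filter, mem_univ, true_and]
  split_ifs with ha
  · simp only [mem_erase, ne_eq, mem_univ, and_true, nonempty_iff_ne_empty, ha, iff_true]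
  · simp only [mem_singleton, ha, iff_false, not_nonempty_iff_eq_empty]

end Helpers

/-- **The blow-up identity** `Z_{G[K̄_t]}(z) = Z_G((1 + z) ^ t - 1)`: the independence polynomial
of the blow-up of `G` in which every vertex becomes `t` pairwise non-adjacent twins and every edge
a `K_{t,t}` (the graph `SimpleGraph.comap Prod.fst G` on `V × Fin t`) is the independence
polynomial of `G` at the shifted activity `(1 + z) ^ t - 1`. [folklore] -/
theorem stub_blowup {V : Type*} [Fintype V] [DecidableEq V] (G : SimpleGraph V) [DecidableRel G.Adj] (t : ℕ)
    {R : Type*} [CommRing R] (z : R) :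
    independencePolynomial (SimpleGraph.comap Prod.fst G : SimpleGraph (V × Fin t)) z =
      independencePolynomial G ((1 + z) ^ t - 1) := by
  -- the fibre box of a prospective support `J`
  set T : Finset V → V → Finset (Finset (Fin t)) := fun J a =>
    if a ∈ J then (univ : Finset (Finset (Fin t))).erase ∅ else {∅}
  -- both sides equal the sum over fibre functions `φ : V → Finset (Fin t)`
  have rhs : independencePolynomial G ((1 + z) ^ t - 1) =
      ∑ φ : V → Finset (Fin t),
        if G.IsIndepSet ↑(univ.filter fun a : V => (φ a).Nonempty) then ∏ a, z ^ (φ a).card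
        else 0 := by
    unfold independencePolynomial
    calc ∑ J : Finset V, (if G.IsIndepSet ↑J then ((1 + z) ^ t - 1) ^ J.card else 0)
        = ∑ J : Finset V, ∑ φ ∈ Fintype.piFinset (T J),
            (if G.IsIndepSet ↑J then ∏ a, z ^ (φ a).card else 0) := by
          refine Fintype.sum_congr _ _ fun J => ?_
          rw [pow_card_eq_sum_piFinset, sum_ite_irrel, sum_const_zero]
      _ = ∑ J : Finset V, ∑ φ : V → Finset (Fin t),
            (if (univ.filter fun a : V => (φ a).Nonempty) = J then
              (if G.IsIndepSet ↑J then ∏ a, z ^ (φ a).card else 0) else 0) := by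
          refine Fintype.sum_congr _ _ fun J => ?_
          have hS : Fintype.piFinset (T J) = univ.filter fun φ : V → Finset (Fin t) =>
              (univ.filter fun a : V => (φ a).Nonempty) = J := by
            ext φ
            rw [mem_piFinset_iff_filter_nonempty_eq, mem_filter, and_iff_right (mem_univ _)]
          rw [hS, sum_filter]
      _ = ∑ φ : V → Finset (Fin t), ∑ J : Finset V,
            (if (univ.filter fun a : V => (φ a).Nonempty) = J then
              (if G.IsIndepSet ↑J then ∏ a, z ^ (φ a).card else 0) else 0) := sum_comm
      _ = _ := by
          refine Fintype.sum_congr _ _ fun φ => ?_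
          rw [sum_ite_eq, if_pos (mem_univ _)]
  have lhs : independencePolynomial (SimpleGraph.comap Prod.fst G : SimpleGraph (V × Fin t)) z =
      ∑ φ : V → Finset (Fin t),
        if G.IsIndepSet ↑(univ.filter fun a : V => (φ a).Nonempty) then ∏ a, z ^ (φ a).card
        else 0 := by
    unfold independencePolynomial
    symm
    refine Fintype.sum_bijective (fun φ : V → Finset (Fin t) =>
        univ.filter fun p : V × Fin t => p.2 ∈ φ p.1) ?_ _ _ fun φ => ?_
    · refine Function.bijective_iff_has_inverse.2
        ⟨fun I a => univ.filter fun i => (a, i) ∈ I, fun φ => ?_, fun I => ?_⟩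
      · ext a i
        simp only [mem_filter, mem_univ, true_and]
      · ext ⟨a, i⟩
        simp only [mem_filter, mem_univ, true_and]
    · rw [pow_card_filter_eq_prod]
      exact if_congr (isIndepSet_comap_fst_filter_iff G t φ).symm rfl rfl
  rw [lhs, rhs]

end Summit.PneNP.PneNP.Theorems.NoFBPPApproxAboveUniqueness
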